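import Literature.InformationTheory.StateDiscrimination.TensorPowerDiscrimination
import Mathlib.Analysis.SpecialFunctions.Pow.Real
import Mathlib.Analysis.SpecialFunctions.Exp
import HarnessLib

/-!
# Barrier: normalised-state output of diverging trajectories costs `Ω(1/ε) = e^{Ω(T)}` input copies (Lewis–Eidenbenz–Nadiga–Subaşı 2024, Lemmas 1–2)

D-0021 barrier file for the summit `QuantumAdvantage` (cell `pub-qadeq`, linear/nonlinear
differential-equation lane: rows A-13 Liu et al. PNAS 2021 Carleman, A-142 Li et al. PRR 2025
Carleman-linearised lattice Boltzmann turbulence / CLAIMS §1 OPEN-38, A-116, A-111, A-121).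
HONEST FRAMING: instance-level adjudication of specific advantage claims; no claim about BQP vs BPP
or the summit.

**Source.** D. Lewis, S. Eidenbenz, B. Nadiga, Y. Subaşı, *Limitations for Quantum Algorithms to
Solve Turbulent and Chaotic Systems*, Quantum **8**, 1509 (2024), doi:10.22331/q-2024-10-24-1509 =
arXiv:2307.09593v2 [LewisEtAl2024]. Held text `paper:arxiv-2307.09593` (source
chunks p0005–p0006, p0008–p0009).

* Lemma 1 (= Lemma 6 of Liu et al. PNAS 2021), p0005 L6–L11: "Given a black box that prepares either
  `|ψ⟩` or `|φ⟩`, with `⟨ψ|φ⟩ = 1 − ε`, then `Ω(1/ε)` queries are required to distinguish the two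
  states. *Proof.* … With `k` queries … we can prepare either state `|ψ⟩^{⊗k}` or `|φ⟩^{⊗k}`. The
  overlap of these states is `(1−ε)^k`. For pure states the trace distance is
  `d = √(1 − ⟨ψ|φ⟩^{2k}) = √(1 − (1−ε)^{2k})` and satisfies `d ≤ √(2kε)`."
* Lemma 2, p0005 L15–L28: "A black box generates one of two states `|ψ₀⟩` or `|φ₀⟩` with overlap
  `⟨ψ₀|φ₀⟩ = 1 − ε` … If the overlap of these two states under evolution that simulates the
  solution of a differential equation is reduced to `⟨ψ(T)|φ(T)⟩ ≤ 2/√5` in time `T = O(log(1/ε))`,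
  then the number of queries to the black box needed to solve the differential equation is
  exponential in `T`. *Proof.* … the trace distance between the two states is … `≥ 1/√5` … As trace
  distance is non-increasing under quantum operations, sufficient number of copies of the two states
  must be provided to the quantum algorithm. From `‖|ψ(0)⟩^{⊗k} − |φ(0)⟩^{⊗k}‖_tr ≤ √(2kε)`, we
  require `k > 1/(10ε)` queries to give a separation of `1/√5`. Since `ε` is exponentially small in
  integration time `T`, simulating up to `T` requires a number of queries exponential in `T`."
* Theorem 3, p0005 L33ff (the dynamical input, NOT formalised here): for the coupled ODE
  `u₁' = −u₁ + R* u₁²`, `u₂' = −u₂ − u₁` (`R ≥ 1`) and initial states `|ψ₀⟩ = (1−ε)|0⟩ + δ|1⟩`,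
  `|φ₀⟩ = |0⟩` (overlap `1 − ε`, `0 < ε < e^{−3}`), the normalised solutions satisfy
  `|⟨ψ(t*)|φ(t*)⟩| ≤ 2/√5` at `t* = 3 ln(1/ε)` (p0006 L55–L63); Theorem 5 (p0008 L48ff) argues the same
  overlap decay in time `O(λ⁻¹ log(1/ε))` for flows with a positive Lyapunov exponent `λ` and
  sub-exponentially growing solution norms.

Structured summary (D-0021):
* technique_class: ANY quantum algorithm that consumes `k` copies of (equivalently, `k` queries to a
  preparation oracle for) the normalised initial-data state and applies a trace-preserving quantum
  operation followed by a measurement — the Lean `CopyAlgorithm k X m ι` below (rectangular Kraus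
  family `A_i : (Fin k → X) → m` with `Σ A_i† A_i = 1`) together with an arbitrary output effect; this
  covers quantum Carleman linearisation (QCL), LCHS / Schrödingerisation / QLSA-based ODE solvers and
  any other circuit, since only the number of input copies is counted
  [cite: LewisEtAl2024, §2 Lemma 2 and §3 Theorem 5 ("applies to any quantum algorithm that approximately prepares a normalised quantum state with amplitudes proportional to the solution vector", p0010 L3)].
* blocks: polynomial-in-`T` quantum algorithms whose OUTPUT is the normalised solution state
  `|u(T)⟩/‖u(T)‖` of a nonlinear ODE/PDE in a regime where nearby normalised trajectories separate to
  constant trace distance within `T = O(log(1/ε))` — the `R ≥ 1` family of Theorem 3 and, by Theorem 5,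
  chaotic / turbulent regimes with a positive Lyapunov exponent (the turbulence claims of CLAIMS rows
  A-142 / A-13's `R ≥ 1` side) [cite: LewisEtAl2024, Thms 3 and 5].
* because: two admissible initial states with overlap `1 − ε` have `k`-copy overlap `(1−ε)^k`, so
  every effect applied after any trace-preserving operation on the `k` copies separates them by at
  most `√(1 − (1−ε)^{2k}) ≤ √(2kε)` (Helstrom; trace distance is contractive), while the two target
  output states are `≥ 1/√5` apart — hence `k ≥ 1/(10ε)`, and `ε = e^{−T/3}` for the Theorem-3 family
  [cite: LewisEtAl2024, Lemmas 1–2 (p0005)]. PROVED below: `effectGap_copies_le`,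
  `copies_ge_of_gap`, `copies_ge_of_exact_output`, `copies_exponential_in_time`.
* evasions_known: (i) dissipative regimes `R < 1` where trajectories CONTRACT (Liu et al. PNAS 2021,
  Thm 1 as corrected 2026 — the tree's `Literature.Analysis.ODE.CarlemanTruncation`), the paper's own
  dichotomy [cite: LewisEtAl2024, §1 and §4]; (ii) outputs that are NOT the normalised
  state — a single expectation value / history-state functionals to inverse-polynomial error (the
  route taken by A-142, p0016 of arXiv:2303.16550v3) are outside the technique class as stated, the
  bound constraining them only through whatever state-discrimination power the functional retains
  [cite: LewisEtAl2024, §5 p0011 L7–L9 ("larger classes … an open question")];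
  (iii) many-copies / ensemble inputs are exactly what the bound counts, not an evasion.
* scope_caveats: the PROVED part is the information-theoretic core (Lemmas 1–2) for EXACT or
  effect-level outputs; the dynamical premise — that the flow reduces overlap `1 − ε` to `≤ 2/√5`
  within `T = 3 ln(1/ε)` (Thm 3, explicit 2-D family) or `O(λ⁻¹ ln(1/ε))` (Thm 5, finite-time Lyapunov
  heuristics, "we propose", p0011 L9) — enters below only as the HYPOTHESIS `‖⟨u|v⟩‖ ≤ 2/√5` on the
  two target states and is not formalised; the folklore reading "quantum computers cannot simulate
  turbulence" over-claims: the paper proves a worst-case family and argues the chaotic case, for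
  state output only.
* status: established (refereed, Quantum 2024; the Lemma-1 step is Liu et al. PNAS 2021 Lemma 6).

What is here (all proved, 0 named facts, 0 sorry): the technique class `CopyAlgorithm` with its
output state `output` and Heisenberg dual `dual` (`trace_mul_output`, `dual_effect` — Nielsen–Chuang
§8.2.3 duality for RECTANGULAR Kraus families, the tree's `TraceDistanceContraction` being square);
`one_sub_pow_le` (Bernoulli: `1 − (1−ε)^{2k} ≤ 2kε`); `effectGap_copies_le` (Lemma 1: any effect on
`k` copies separates `ψ^{⊗k}`, `φ^{⊗k}` by `≤ √(2kε)`); `outputGap_le` (the same after any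
`CopyAlgorithm`, Lemma 2's contraction step); `copies_ge_of_gap` (gap `≥ 1/√5` forces
`k ≥ 1/(10ε)`, the printed constant); `copies_ge_of_exact_output` (an algorithm whose outputs ARE
target pure states `u, v` with `‖⟨u|v⟩‖ ≤ 2/√5` needs `k ≥ 1/(10ε)`); `copies_exponential_in_time`
(`ε = e^{−T/3}` ⇒ `k ≥ e^{T/3}/10`).
Bounded-error outputs ("any bounded-error quantum algorithm that gives a quantum state with
amplitudes proportional to the solution vector", Thm 3): `approx_gap_le_sqrt` and
`copies_ge_of_approx_output` — if each output is `η`-close to its target in the operational sense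
(every effect's expectation moves by at most `η`), then `1/√5 − 2η ≤ √(2kε)`, so for `η ≤ 1/(4√5)`
still `k ≥ 1/(40ε)`.

## References
* [LewisEtAl2024] D. Lewis, S. Eidenbenz, B. Nadiga, Y. Subaşı, Quantum 8, 1509
  (2024), arXiv:2307.09593v2, §2 Lemmas 1–2, Theorem 3; §3 Theorem 5.
* [LiuEtAl2021Carleman] J.-P. Liu et al., PNAS 118 (2021) e2026805118, Lemma 6 (= Lemma 1 above).
* [NielsenChuang2010] Nielsen–Chuang §8.2.3 (operator-sum representation, duality), §9.2.
* [Barnett2009] S. Barnett, *Quantum Information*, §4.4 (pure-state Helstrom bound; tree file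
  `PureStateHelstromBound`).
-/

noncomputable section

open scoped BigOperators ComplexOrder
open Matrix Finset

namespace Literature.Barriers.QuantumAdvantage.ChaoticDynamicsCopies

open Literature.InformationTheory.StateDiscrimination
open Literature.InformationTheory.StateDiscrimination.TensorPowerDiscrimination
  (tensorPower star_tensorPower_dotProduct tensorPower_normSq)

/-! ### 1. The technique class: trace-preserving operations on `k` input copies -/

/-- **Technique class.** A quantum algorithm that consumes `k` copies of an initial-data state on the
register `X` (equivalently makes `k` queries to its preparation oracle), then applies an arbitrary
trace-preserving quantum operation with output register `m`, in operator-sum form: rectangular Kraus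
operators `A_i : ℂ^{(Fin k → X)} → ℂ^m` with `Σ_i A_i† A_i = 1`. Any final measurement is an effect on
`m` (see `outputGap_le`). [cite: LewisEtAl2024, §2 Lemma 2 ("copies of the two states must be provided to the quantum algorithm")]; [cite: NielsenChuang2010, §8.2.3] -/
structure CopyAlgorithm (k : ℕ) (X m ι : Type*) [Fintype X] [DecidableEq X] [Fintype m]
    [Fintype ι] where
  /-- the Kraus operators, from the `k`-copy input register to the output register -/
  kraus : ι → Matrix m (Fin k → X) ℂ
  /-- trace preservation `Σ_i A_i† A_i = 1` -/
  tp : ∑ i, (kraus i)ᴴ * kraus i = 1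

namespace CopyAlgorithm

variable {k : ℕ} {X m ι : Type*} [Fintype X] [DecidableEq X] [Fintype m] [Fintype ι]

/-- Output state on the pure input `v` (a vector on the `k`-copy register):
`𝓔(|v⟩⟨v|) = Σ_i A_i |v⟩⟨v| A_i†`. [cite: NielsenChuang2010, §8.2.3] -/
def output (𝓐 : CopyAlgorithm k X m ι) (v : (Fin k → X) → ℂ) : Matrix m m ℂ :=
  ∑ i, 𝓐.kraus i * vecMulVec v (star v) * (𝓐.kraus i)ᴴ

/-- Heisenberg-picture dual `𝓔†(P) = Σ_i A_i† P A_i`, an operator on the input register.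
[cite: NielsenChuang2010, §8.2.3] -/
def dual (𝓐 : CopyAlgorithm k X m ι) (P : Matrix m m ℂ) : Matrix (Fin k → X) (Fin k → X) ℂ :=
  ∑ i, (𝓐.kraus i)ᴴ * P * 𝓐.kraus i

/-- Duality on pure inputs: `tr(P · 𝓔(|v⟩⟨v|)) = ⟨v| 𝓔†(P) |v⟩`. [cite: NielsenChuang2010, §8.2.3] -/
theorem trace_mul_output (𝓐 : CopyAlgorithm k X m ι) (P : Matrix m m ℂ) (v : (Fin k → X) → ℂ) :
    (P * 𝓐.output v).trace = star v ⬝ᵥ (𝓐.dual P *ᵥ v) := by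
  unfold output dual
  rw [Matrix.mul_sum, trace_sum, Matrix.sum_mulVec, dotProduct_sum]
  refine sum_congr rfl fun i _ => ?_
  rw [← Matrix.mul_assoc, ← Matrix.mul_assoc, Matrix.trace_mul_comm, ← Matrix.mul_assoc,
    mul_vecMulVec, trace_vecMulVec, dotProduct_comm, Matrix.mul_assoc]

variable [DecidableEq m]

/-- `𝓔†` maps effects to effects (`0 ≤ 𝓔†(P)` and `0 ≤ 1 − 𝓔†(P) = 𝓔†(1 − P)`), rectangular Kraus
version. [cite: NielsenChuang2010, §8.2.3] -/
theorem dual_effect (𝓐 : CopyAlgorithm k X m ι) {P : Matrix m m ℂ} (hP : P.PosSemidef)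
    (hP' : (1 - P).PosSemidef) : (𝓐.dual P).PosSemidef ∧ (1 - 𝓐.dual P).PosSemidef := by
  have hdual : ∀ {Q : Matrix m m ℂ}, Q.PosSemidef → (𝓐.dual Q).PosSemidef := by
    intro Q hQ
    unfold dual
    exact posSemidef_sum _ fun i _ => hQ.conjTranspose_mul_mul_same (𝓐.kraus i)
  refine ⟨hdual hP, ?_⟩
  have e : 1 - 𝓐.dual P = 𝓐.dual (1 - P) := by
    unfold dual
    simp_rw [Matrix.mul_sub, Matrix.sub_mul, Matrix.mul_one]
    rw [Finset.sum_sub_distrib, 𝓐.tp]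
  rw [e]
  exact hdual hP'

end CopyAlgorithm

/-! ### 2. Lemma 1: `k` copies of states with overlap `1 − ε` stay `√(2kε)`-indistinguishable -/

variable {X : Type*} [Fintype X] [DecidableEq X]

/-- Bernoulli step of Lemma 1: if `‖γ‖ ≥ 1 − ε` (`‖γ‖ ≥ 0`) then `1 − ‖γ‖^{2k} ≤ 2kε`
("`d = √(1 − (1−ε)^{2k})` … satisfies `d ≤ √(2kε)`"). [cite: LewisEtAl2024, §2 Lemma 1 (proof)] -/
theorem one_sub_pow_le {g ε : ℝ} (hg0 : 0 ≤ g) (hε : 1 - ε ≤ g) (k : ℕ) :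
    1 - g ^ (2 * k) ≤ 2 * k * ε := by
  -- Bernoulli: `1 + (2k)(g − 1) ≤ (1 + (g − 1))^{2k} = g^{2k}`
  have hB := one_add_mul_le_pow (show (-2 : ℝ) ≤ g - 1 by linarith) (2 * k)
  rw [add_sub_cancel] at hB
  push_cast at hB
  have h1 : (2 * (k : ℝ)) * (-ε) ≤ (2 * (k : ℝ)) * (g - 1) :=
    mul_le_mul_of_nonneg_left (by linarith) (by positivity)
  linarith

/-- **Lemma 1 (effect form).** For unit `ψ, φ` with `‖⟨ψ|φ⟩‖ ≥ 1 − ε` and ANY effect `E` on the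
`k`-copy register: `Re⟨ψ^{⊗k}|E|ψ^{⊗k}⟩ − Re⟨φ^{⊗k}|E|φ^{⊗k}⟩ ≤ √(2kε)` — no measurement on `k`
copies separates the two hypotheses by more than `√(2kε)`, so `Ω(1/ε)` copies are needed for a
constant separation. [cite: LewisEtAl2024, §2 Lemma 1]; [cite: Barnett2009, §4.4 eqs. (4.55)–(4.58)] -/
theorem effectGap_copies_le {k : ℕ} {E : Matrix (Fin k → X) (Fin k → X) ℂ} (hE : E.PosSemidef)
    (hE' : (1 - E).PosSemidef) {ψ φ : X → ℂ} (hψ : star ψ ⬝ᵥ ψ = 1) (hφ : star φ ⬝ᵥ φ = 1)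
    {ε : ℝ} (hε : 1 - ε ≤ ‖star ψ ⬝ᵥ φ‖) :
    (star (tensorPower ψ k) ⬝ᵥ (E *ᵥ tensorPower ψ k)).re
      - (star (tensorPower φ k) ⬝ᵥ (E *ᵥ tensorPower φ k)).re ≤ Real.sqrt (2 * k * ε) := by
  have hgap := PureStateHelstromBound.effect_gap_le_sqrt hE hE' (tensorPower_normSq hψ k)
    (tensorPower_normSq hφ k)
  rw [star_tensorPower_dotProduct, norm_pow, ← pow_mul, mul_comm k 2] at hgap
  refine hgap.trans (Real.sqrt_le_sqrt ?_)
  exact one_sub_pow_le (norm_nonneg _) hε k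

/-! ### 3. Lemma 2: through any trace-preserving algorithm on the `k` copies -/

variable {m ι : Type*} [Fintype m] [DecidableEq m] [Fintype ι]

/-- **Contraction step of Lemma 2.** For any `CopyAlgorithm` on `k` copies and any output effect `P`,
the two output states are separated by `P` by at most `√(2kε)` ("as trace distance is
non-increasing under quantum operations …"). [cite: LewisEtAl2024, §2 Lemma 2 (proof)]; [cite: NielsenChuang2010, §9.2.1 Thm 9.2] -/
theorem outputGap_le {k : ℕ} (𝓐 : CopyAlgorithm k X m ι) {P : Matrix m m ℂ} (hP : P.PosSemidef)
    (hP' : (1 - P).PosSemidef) {ψ φ : X → ℂ} (hψ : star ψ ⬝ᵥ ψ = 1) (hφ : star φ ⬝ᵥ φ = 1)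
    {ε : ℝ} (hε : 1 - ε ≤ ‖star ψ ⬝ᵥ φ‖) :
    (P * 𝓐.output (tensorPower ψ k)).trace.re - (P * 𝓐.output (tensorPower φ k)).trace.re
      ≤ Real.sqrt (2 * k * ε) := by
  rw [𝓐.trace_mul_output, 𝓐.trace_mul_output]
  obtain ⟨h1, h2⟩ := 𝓐.dual_effect hP hP'
  exact effectGap_copies_le h1 h2 hψ hφ hε

/-- **Lemma 2 (the printed constant): a separation of `1/√5` needs `k ≥ 1/(10ε)` copies.**  If some
output effect separates the two outputs of a `CopyAlgorithm` on `k` copies by at least `1/√5`, then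
`k ≥ 1/(10ε)` ("we require `k > 1/(10ε)` queries to give a separation of `1/√5`").
[cite: LewisEtAl2024, §2 Lemma 2] -/
theorem copies_ge_of_gap {k : ℕ} (𝓐 : CopyAlgorithm k X m ι) {P : Matrix m m ℂ} (hP : P.PosSemidef)
    (hP' : (1 - P).PosSemidef) {ψ φ : X → ℂ} (hψ : star ψ ⬝ᵥ ψ = 1) (hφ : star φ ⬝ᵥ φ = 1)
    {ε : ℝ} (hε0 : 0 < ε) (hε : 1 - ε ≤ ‖star ψ ⬝ᵥ φ‖)
    (hgap : 1 / Real.sqrt 5 ≤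
      (P * 𝓐.output (tensorPower ψ k)).trace.re - (P * 𝓐.output (tensorPower φ k)).trace.re) :
    1 / (10 * ε) ≤ k := by
  have h := hgap.trans (outputGap_le 𝓐 hP hP' hψ hφ hε)
  -- square both sides: `1/5 ≤ 2kε`
  have h5 : (0 : ℝ) < Real.sqrt 5 := Real.sqrt_pos.mpr (by norm_num)
  have hkε : 0 ≤ 2 * (k : ℝ) * ε := by positivity
  have hsq : (1 / Real.sqrt 5) ^ 2 ≤ (Real.sqrt (2 * k * ε)) ^ 2 :=
    pow_le_pow_left₀ (by positivity) h 2
  rw [div_pow, one_pow, Real.sq_sqrt (by norm_num : (0:ℝ) ≤ 5), Real.sq_sqrt hkε] at hsq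
  rw [div_le_iff₀ (by positivity)]
  nlinarith

/-- **Lemma 2 for an algorithm that outputs the target states exactly.**  Let the `CopyAlgorithm`
map `ψ₀^{⊗k} ↦ |u⟩⟨u|` and `φ₀^{⊗k} ↦ |v⟩⟨v|` for unit target states with `‖⟨u|v⟩‖ ≤ 2/√5` (the
normalised solutions at time `T`, "reduced to `⟨ψ(T)|φ(T)⟩ ≤ 2/√5`"), where `‖⟨ψ₀|φ₀⟩‖ ≥ 1 − ε`,
`ε > 0`. Then `k ≥ 1/(10ε)`: the Helstrom effect of `u, v` separates the outputs by
`√(1 − ‖⟨u|v⟩‖²) ≥ 1/√5`. [cite: LewisEtAl2024, §2 Lemma 2]; [cite: NielsenChuang2010, §9.2.3 eq. (9.99)] -/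
theorem copies_ge_of_exact_output {k : ℕ} (𝓐 : CopyAlgorithm k X m ι) {ψ φ : X → ℂ}
    (hψ : star ψ ⬝ᵥ ψ = 1) (hφ : star φ ⬝ᵥ φ = 1) {ε : ℝ} (hε0 : 0 < ε)
    (hε : 1 - ε ≤ ‖star ψ ⬝ᵥ φ‖) {u v : m → ℂ} (hu : star u ⬝ᵥ u = 1) (hv : star v ⬝ᵥ v = 1)
    (huv : ‖star u ⬝ᵥ v‖ ≤ 2 / Real.sqrt 5)
    (hout : 𝓐.output (tensorPower ψ k) = vecMulVec u (star u))
    (hout' : 𝓐.output (tensorPower φ k) = vecMulVec v (star v)) :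
    1 / (10 * ε) ≤ k := by
  obtain ⟨E, hE, hE', hgap⟩ := PureStateHelstromBound.effect_gap_eq_sqrt_exists hu hv
  refine copies_ge_of_gap 𝓐 hE hE' hψ hφ hε0 hε ?_
  rw [hout, hout', mul_vecMulVec, mul_vecMulVec, trace_vecMulVec, trace_vecMulVec,
    dotProduct_comm _ (star u), dotProduct_comm _ (star v), hgap]
  -- `1/√5 ≤ √(1 − ‖⟨u|v⟩‖²)` from `‖⟨u|v⟩‖² ≤ 4/5`
  have h5 : (0 : ℝ) < Real.sqrt 5 := Real.sqrt_pos.mpr (by norm_num)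
  have hsq : ‖star u ⬝ᵥ v‖ ^ 2 ≤ 4 / 5 := by
    have := pow_le_pow_left₀ (norm_nonneg _) huv 2
    rwa [div_pow, Real.sq_sqrt (by norm_num : (0:ℝ) ≤ 5), show (2:ℝ) ^ 2 / 5 = 4 / 5 by norm_num]
      at this
  rw [Real.le_sqrt' (by positivity), div_pow, one_pow, Real.sq_sqrt (by norm_num : (0:ℝ) ≤ 5)]
  linarith

/-- **"Exponential in integration time."** With the Theorem-3 calibration `ε = e^{−T/3}` (overlap
`≤ 2/√5` is reached at `T = t* = 3 ln(1/ε)`), an exact-output algorithm needs `k ≥ e^{T/3}/10`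
input copies. [cite: LewisEtAl2024, §2 Lemma 2 with Theorem 3 (p0006: "evolve for time t* = 3 log(1/ε)")] -/
theorem copies_exponential_in_time {k : ℕ} (𝓐 : CopyAlgorithm k X m ι) {ψ φ : X → ℂ}
    (hψ : star ψ ⬝ᵥ ψ = 1) (hφ : star φ ⬝ᵥ φ = 1) {T : ℝ}
    (hε : 1 - Real.exp (-(T / 3)) ≤ ‖star ψ ⬝ᵥ φ‖) {u v : m → ℂ} (hu : star u ⬝ᵥ u = 1)
    (hv : star v ⬝ᵥ v = 1) (huv : ‖star u ⬝ᵥ v‖ ≤ 2 / Real.sqrt 5)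
    (hout : 𝓐.output (tensorPower ψ k) = vecMulVec u (star u))
    (hout' : 𝓐.output (tensorPower φ k) = vecMulVec v (star v)) :
    Real.exp (T / 3) / 10 ≤ k := by
  have h := copies_ge_of_exact_output 𝓐 hψ hφ (Real.exp_pos _) hε hu hv huv hout hout'
  have e : 1 / (10 * Real.exp (-(T / 3))) = Real.exp (T / 3) / 10 := by
    rw [Real.exp_neg]; field_simp
  rwa [e] at h

/-! ### 4. Bounded-error (approximate) outputs -/

/-- **Lemma 2 with bounded-error outputs.** If the two outputs of a `CopyAlgorithm` on `k` copies
are `η`-close to unit targets `u, v` in the operational sense — every effect's expectation differs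
by at most `η` (i.e. trace distance `≤ η`) — and `‖⟨u|v⟩‖ ≤ 2/√5`, then `1/√5 − 2η ≤ √(2kε)`.
[cite: LewisEtAl2024, §2 Lemma 2 with Thm 3 ("any bounded-error quantum algorithm that gives a quantum state with amplitudes proportional to the solution vector")] -/
theorem approx_gap_le_sqrt {k : ℕ} (𝓐 : CopyAlgorithm k X m ι) {ψ φ : X → ℂ}
    (hψ : star ψ ⬝ᵥ ψ = 1) (hφ : star φ ⬝ᵥ φ = 1) {ε : ℝ} (hε : 1 - ε ≤ ‖star ψ ⬝ᵥ φ‖)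
    {u v : m → ℂ} (hu : star u ⬝ᵥ u = 1) (hv : star v ⬝ᵥ v = 1)
    (huv : ‖star u ⬝ᵥ v‖ ≤ 2 / Real.sqrt 5) {η : ℝ}
    (hψout : ∀ P : Matrix m m ℂ, P.PosSemidef → (1 - P).PosSemidef →
      |(P * 𝓐.output (tensorPower ψ k)).trace.re - (star u ⬝ᵥ (P *ᵥ u)).re| ≤ η)
    (hφout : ∀ P : Matrix m m ℂ, P.PosSemidef → (1 - P).PosSemidef →
      |(P * 𝓐.output (tensorPower φ k)).trace.re - (star v ⬝ᵥ (P *ᵥ v)).re| ≤ η) :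
    1 / Real.sqrt 5 - 2 * η ≤ Real.sqrt (2 * k * ε) := by
  obtain ⟨E, hE, hE', hgap⟩ := PureStateHelstromBound.effect_gap_eq_sqrt_exists hu hv
  have hout := outputGap_le 𝓐 hE hE' hψ hφ hε
  have h1 := hψout E hE hE'
  have h2 := hφout E hE hE'
  rw [abs_le] at h1 h2
  -- the targets' Helstrom gap is ≥ 1/√5
  have h5 : (0 : ℝ) < Real.sqrt 5 := Real.sqrt_pos.mpr (by norm_num)
  have hsq : ‖star u ⬝ᵥ v‖ ^ 2 ≤ 4 / 5 := by
    have := pow_le_pow_left₀ (norm_nonneg _) huv 2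
    rwa [div_pow, Real.sq_sqrt (by norm_num : (0:ℝ) ≤ 5), show (2:ℝ) ^ 2 / 5 = 4 / 5 by norm_num]
      at this
  have htar : 1 / Real.sqrt 5 ≤ (star u ⬝ᵥ (E *ᵥ u)).re - (star v ⬝ᵥ (E *ᵥ v)).re := by
    rw [hgap, Real.le_sqrt' (by positivity), div_pow, one_pow, Real.sq_sqrt (by norm_num : (0:ℝ) ≤ 5)]
    linarith
  linarith

/-- **Copy lower bound for bounded-error outputs: `η ≤ 1/(4√5)` ⇒ `k ≥ 1/(40ε)`.**
[cite: LewisEtAl2024, §2 Lemma 2 with Thm 3 (bounded-error algorithms)] -/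
theorem copies_ge_of_approx_output {k : ℕ} (𝓐 : CopyAlgorithm k X m ι) {ψ φ : X → ℂ}
    (hψ : star ψ ⬝ᵥ ψ = 1) (hφ : star φ ⬝ᵥ φ = 1) {ε : ℝ} (hε0 : 0 < ε)
    (hε : 1 - ε ≤ ‖star ψ ⬝ᵥ φ‖) {u v : m → ℂ} (hu : star u ⬝ᵥ u = 1) (hv : star v ⬝ᵥ v = 1)
    (huv : ‖star u ⬝ᵥ v‖ ≤ 2 / Real.sqrt 5) {η : ℝ} (hη : η ≤ 1 / (4 * Real.sqrt 5))
    (hψout : ∀ P : Matrix m m ℂ, P.PosSemidef → (1 - P).PosSemidef →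
      |(P * 𝓐.output (tensorPower ψ k)).trace.re - (star u ⬝ᵥ (P *ᵥ u)).re| ≤ η)
    (hφout : ∀ P : Matrix m m ℂ, P.PosSemidef → (1 - P).PosSemidef →
      |(P * 𝓐.output (tensorPower φ k)).trace.re - (star v ⬝ᵥ (P *ᵥ v)).re| ≤ η) :
    1 / (40 * ε) ≤ k := by
  have h := approx_gap_le_sqrt 𝓐 hψ hφ hε hu hv huv hψout hφout
  have h5 : (0 : ℝ) < Real.sqrt 5 := Real.sqrt_pos.mpr (by norm_num)
  -- `1/√5 − 2η ≥ 1/(2√5)`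
  have hη' : 1 / (2 * Real.sqrt 5) ≤ 1 / Real.sqrt 5 - 2 * η := by
    have : 2 * η ≤ 1 / (2 * Real.sqrt 5) := by
      calc 2 * η ≤ 2 * (1 / (4 * Real.sqrt 5)) := by linarith
        _ = 1 / (2 * Real.sqrt 5) := by field_simp; ring
    have e : 1 / Real.sqrt 5 = 1 / (2 * Real.sqrt 5) + 1 / (2 * Real.sqrt 5) := by field_simp; ring
    linarith
  have hle : 1 / (2 * Real.sqrt 5) ≤ Real.sqrt (2 * k * ε) := hη'.trans h
  have hkε : 0 ≤ 2 * (k : ℝ) * ε := by positivity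
  have hsq : (1 / (2 * Real.sqrt 5)) ^ 2 ≤ (Real.sqrt (2 * k * ε)) ^ 2 :=
    pow_le_pow_left₀ (by positivity) hle 2
  rw [div_pow, one_pow, mul_pow, Real.sq_sqrt (by norm_num : (0:ℝ) ≤ 5), Real.sq_sqrt hkε] at hsq
  rw [div_le_iff₀ (by positivity)]
  nlinarith

end Literature.Barriers.QuantumAdvantage.ChaoticDynamicsCopies

end
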